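import Summits.BirchSwinnertonDyer.Rank1Residual.Supersingular.TowerSurjectivityX7
import Literature.NumberTheory.EllipticCurves.Kato2004.ThreeAdicFrobeniusCertificate
import HarnessLib

/-!
# The supersingular axis at `p = 3` without Wuthrich's Lemma 20, last part: the `3`-adic tower from
# ONE Frobenius mod `9` (lit-kato's certificate) plugged into the X8 / X7@3 per-pair readings
# (cell `b2b-bsdres`, supersingular family, prover B = unit `b2b-bsdres-additive-p3`, gen 16)

HONEST FRAMING (run/shared/lean/b2b/bsd-rank1-residual/, verbatim in every file): the goal of the
cell is to DELETE the COMBINATION-SHAPED residual classes of the Birch–Swinnerton-Dyer formula for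
ALL analytic-rank `≤ 1` elliptic curves over `ℚ` — "full BSD formula for every rank `≤ 1` curve in
class `C`" assembled STRICTLY from published theorems — so that the rank-`≤ 1` remainder becomes
exactly the CONSTRUCTION-SHAPED classes, which are TYPED (missing-input `Prop`s), NOT attempted.
This is not "finishing BSD". THEOREMS ONLY (no definition, no named fact, nothing about any
particular curve asserted); X8 / X7 stay CONSTRUCTION-SHAPED; nothing is booked.

## What this file does

`TowerSurjectivityOfRam.lean` / `TowerSurjectivitySemistable.lean` / `TowerSurjectivityX7.lean` (same
gen) re-assembled the X8 (♯/♭) and X7/X6 (±) rank-one / rank-zero per-pair readings with the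
`p`-adic TOWER `∀ n, ρ̄_{E,pⁿ}` onto as a hypothesis (`_of_tower`) and supplied it from (ram) or from
level-lowering. lit-kato GEN 6 proved a third, CERTIFICATE source at `p = 3` that needs nothing about
the reduction at `3`: `WeierstrassCurve.forall_hasSurjectiveModNGaloisRep_three_pow_of_frobenius` —
surj(3) and ONE prime `ℓ` of good reduction with `ℓ ≡ 2, 5 (mod 9)` and `a_ℓ ≡ 3, 6 (mod 9)` give the
whole `3`-adic tower (Cayley–Hamilton: `ρ(Frob_ℓ)² = 1 + 3M₀` with `M₀` non-scalar of unit trace;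
Serre IV-23 at level `9`). This file plugs it in:

* `ClassX8.towerSurj_of_frobenius`; `X8.bsdp_of_mazurTate_sharp/flat_of_bkoLink_…_of_frobenius`,
  `X8.charIdealEq_of_lam_eq_one_…_of_frobenius`, `X8.bsdp_iff_span_eq_span_chromaticL_…_of_frobenius`;
* `X7.bsdp_of_mazurTate_odd/even_of_corA5_…_of_frobenius_three` (X7 at `p = 3`, `a_3 = 0`).

So on the WHOLE supersingular axis at `p = 3` the A9 binder (Lemma 20, Elkies' parametrisation) of
the per-pair chains is replaceable by a kernel-checkable datum `(ℓ, a_ℓ mod 9)` (`a_ℓ` = a point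
count on an integer model, `Theorems/Rank1ResidualIntModelReduction.lean`).

CENSUS (this unit, gen 16; pure stdlib, naive point counts on Cremona's minimal models; files
`HOME/b2b-bsdres-additive-p3/g16/census/{frob9_census.py, frob9_witness.tsv, summary_frob9.json}` +
SHA256SUMS; nothing booked): of the 3 211 X8 and 3 328 X7@3 S-b pairs (N < 5·10⁵), **6 537 / 6 539
have a witness prime `ℓ ≤ 1000`** (`ℓ ≡ 2,5`, `a_ℓ ≡ 3,6 (mod 9)`), in particular **all 269 surj(3)
pairs without (ram@3)** (114 X8 + 155 X7@3 — the residual scope of A9 after the (ram) swap); the 2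
pairs without a witness are 118579a1@3, 118579b1@3 (X7, image 3Nn — not surjective, outside every
Kato/Kurihara lever anyway). Reading: granted the per-pair certificates, Lemma 20 is no longer an
input of ANY supersingular per-pair chain of the cell at `p = 3`.

References: [Kato2004Asterisque] (12.5.2); [SerreAbelianLadic1968] IV §3.4 Lemma 3; [Elkies2006] §1;
[Sprung2012] Thm. 7.16, MC 7.21; [Kobayashi2003] Thm. 1.2, 4.1, 7.4; [BurungaleKobayashiOta2023] Cor. A.5.
-/

set_option autoImplicit false

noncomputable section

open scoped Classical MatrixGroups ModularForm

open CongruenceSubgroup WeierstrassCurve Literature.NumberTheory.EllipticCurves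
  Literature.NumberTheory.EllipticCurves.ModularForms
  Literature.NumberTheory.EllipticCurves.Rank1Residual
  Literature.NumberTheory.EllipticCurves.Rank1Residual.Typed
  Literature.NumberTheory.EllipticCurves.Sprung2017
  Literature.NumberTheory.EllipticCurves.Kobayashi2003 ZpExtension
  Literature.NumberTheory.EllipticCurves.BurungaleKobayashiOta2024
  Summit.BirchSwinnertonDyer.Rank1Residual.X1.MuLambda

namespace Summit.BirchSwinnertonDyer.Rank1Residual.Supersingular

/-! ### The tower from one Frobenius, in class vocabulary -/

section Tower

variable (W : WeierstrassCurve ℚ) [W.IsElliptic] [W.IsGloballyMinimal] (p : ℕ) [Fact p.Prime]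

/-- **At `p = 3`: surj(3) and ONE good prime `ℓ ≡ 2,5 (mod 9)` with `a_ℓ ≡ 3,6 (mod 9)` ⟹ every
`ρ̄_{E,3ⁿ}` is onto** — lit-kato's `forall_hasSurjectiveModNGaloisRep_three_pow_of_frobenius`
transported to a prime symbol `p` with `p = 3`. [cite: SerreAbelianLadic1968, Ch. IV §3.4, Lemma 3 (IV-23)]
[cite: Kato2004Asterisque, (12.5.2) in Thm. 12.5 (4) (p. 222)] -/
theorem towerSurj_of_frobenius_of_eq_three (hp3 : p = 3) (hs : Surj W p)
    (ℓ : ℕ) [Fact ℓ.Prime] (hgood : W.HasGoodReductionAtPrime ℓ)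
    (hℓ9 : ℓ % 9 = 2 ∨ ℓ % 9 = 5) (ha9 : W.frobeniusTrace ℓ % 9 = 3 ∨ W.frobeniusTrace ℓ % 9 = 6)
    (n : ℕ) : W.HasSurjectiveModNGaloisRep (p ^ n : ℕ) := by
  subst hp3
  exact W.forall_hasSurjectiveModNGaloisRep_three_pow_of_frobenius hs ℓ hgood hℓ9 ha9 n

/-- **X8 ∧ surj(3) + one Frobenius witness ⟹ the `3`-adic tower.**
[cite: SerreAbelianLadic1968, Ch. IV §3.4, Lemma 3 (IV-23)] -/
theorem ClassX8.towerSurj_of_frobenius (hX : ClassX8 W p) (hs : Surj W p)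
    (ℓ : ℕ) [Fact ℓ.Prime] (hgood : W.HasGoodReductionAtPrime ℓ)
    (hℓ9 : ℓ % 9 = 2 ∨ ℓ % 9 = 5) (ha9 : W.frobeniusTrace ℓ % 9 = 3 ∨ W.frobeniusTrace ℓ % 9 = 6)
    (n : ℕ) : W.HasSurjectiveModNGaloisRep (p ^ n : ℕ) :=
  towerSurj_of_frobenius_of_eq_three W p hX.1 hs ℓ hgood hℓ9 ha9 n

end Tower

/-! ### X8 readings fed by the Frobenius certificate -/

section X8

variable (W : WeierstrassCurve ℚ) [W.IsElliptic] [W.IsGloballyMinimal] (p : ℕ) [Fact p.Prime]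

/-- **X8 ∧ `r_an = 1` ∧ surj(3) + Frobenius witness: the ♯/♭ main conjecture AT THE PAIR from the
λ-certificate — no Lemma 20.** [cite: Sprung2012, Thm. 7.16, Prop. 7.19, Main Conj. 7.21 (pp. 1504–1505)]
[cite: Sprung2024, Lemma 5.6 (p. 41)] [cite: SerreAbelianLadic1968, Ch. IV §3.4, Lemma 3 (IV-23)] -/
theorem X8.charIdealEq_of_lam_eq_one_of_analyticRank_eq_one_of_frobenius
    (hGZK : rank_eq_analyticRank_of_analyticRank_le_one)
    (hX : ClassX8 W p) (hs : Surj W p)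
    (ℓ : ℕ) [Fact ℓ.Prime] (hgoodℓ : W.HasGoodReductionAtPrime ℓ)
    (hℓ9 : ℓ % 9 = 2 ∨ ℓ % 9 = 5) (ha9 : W.frobeniusTrace ℓ % 9 = 3 ∨ W.frobeniusTrace ℓ % 9 = 6)
    (h1 : W.analyticRank = 1) (D : SignedDatum W p) (hC : D.OrderOfVanishing)
    (hKato : (∀ n : ℕ, W.HasSurjectiveModNGaloisRep (p ^ n : ℕ)) → D.UpperDivisibility)
    (hμ : mu D.L = 0) (hlam : lam D.L = 1) : D.CharIdealEq :=
  X8.charIdealEq_of_lam_eq_one_of_analyticRank_eq_one_of_tower W p hGZK hX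
    (ClassX8.towerSurj_of_frobenius W p hX hs ℓ hgoodℓ hℓ9 ha9) h1 D hC hKato hμ hlam

/-- **X8 ∧ `r_an = 1` ∧ surj(3) + Frobenius witness, colour ♯: `BSD(E,3)` from ONE odd-level
Mazur–Tate certificate and `hBKO` — no Lemma 20.** PER PAIR. [cite: BurungaleKobayashiOta2023, App. A Cor. A.5]
[cite: Sprung2012, Thm. 7.16, Prop. 7.19 and Main Conj. 7.21 (pp. 1504–1505)] [cite: SerreAbelianLadic1968, Ch. IV §3.4, Lemma 3 (IV-23)] -/
theorem X8.bsdp_of_mazurTate_sharp_of_bkoLink_of_analyticRank_eq_one_of_frobenius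
    (hGZK : rank_eq_analyticRank_of_analyticRank_le_one)
    (hX : ClassX8 W p) (hs : Surj W p)
    (ℓ : ℕ) [Fact ℓ.Prime] (hgoodℓ : W.HasGoodReductionAtPrime ℓ)
    (hℓ9 : ℓ % 9 = 2 ∨ ℓ % 9 = 5) (ha9 : W.frobeniusTrace ℓ % 9 = 3 ∨ W.frobeniusTrace ℓ % 9 = 6)
    (h1 : W.analyticRank = 1)
    {N : ℕ} [NeZero N] {f : CuspForm (Gamma0 N) 2} (hf : IsNewformOf W f)
    {Lsharp Lflat : IwasawaAlgebra p} (hSP : IsSprungPair f p (W.frobeniusTrace p) Lsharp Lflat)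
    (ξ : IwasawaAlgebra p) (hC : (PowerSeries.X : IwasawaAlgebra p) ^ W.mordellWeilRank ∣ ξ)
    (hKato : (∀ m : ℕ, W.HasSurjectiveModNGaloisRep (p ^ m : ℕ)) → ξ ∣ Lsharp)
    {n : ℕ} (hn : Odd n) {Θ : IwasawaAlgebra p}
    (hΘ : iwasawaToPowerSeries p Θ =
      ((mazurTateElement f p n).map (algebraMap ℚ ℚ_[p]) : PowerSeries ℚ_[p]))
    (hΘ0 : Θ ≠ 0) (hμ : mu Θ = 0) (hlam : lam Θ = (cyclotomicOmegaPlus p n).natDegree + 1)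
    (hlt : lam Θ < p ^ n)
    (hBKO : Ideal.span ({ξ} : Set (IwasawaAlgebra p)) = Ideal.span {Lsharp} → MissingPPartAt W p) :
    BSDp W p :=
  X8.bsdp_of_mazurTate_sharp_of_bkoLink_of_analyticRank_eq_one_of_tower W p hGZK hX
    (ClassX8.towerSurj_of_frobenius W p hX hs ℓ hgoodℓ hℓ9 ha9) h1 hf hSP ξ hC hKato hn hΘ hΘ0 hμ
    hlam hlt hBKO

/-- **X8 ∧ `r_an = 1` ∧ surj(3) + Frobenius witness, colour ♭: `BSD(E,3)` from ONE even-level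
Mazur–Tate certificate and `hBKO` — no Lemma 20.** PER PAIR. [cite: BurungaleKobayashiOta2023, App. A Cor. A.5]
[cite: Sprung2012, Thm. 7.16, Prop. 7.19 and Main Conj. 7.21 (pp. 1504–1505)] [cite: SerreAbelianLadic1968, Ch. IV §3.4, Lemma 3 (IV-23)] -/
theorem X8.bsdp_of_mazurTate_flat_of_bkoLink_of_analyticRank_eq_one_of_frobenius
    (hGZK : rank_eq_analyticRank_of_analyticRank_le_one)
    (hX : ClassX8 W p) (hs : Surj W p)
    (ℓ : ℕ) [Fact ℓ.Prime] (hgoodℓ : W.HasGoodReductionAtPrime ℓ)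
    (hℓ9 : ℓ % 9 = 2 ∨ ℓ % 9 = 5) (ha9 : W.frobeniusTrace ℓ % 9 = 3 ∨ W.frobeniusTrace ℓ % 9 = 6)
    (h1 : W.analyticRank = 1)
    {N : ℕ} [NeZero N] {f : CuspForm (Gamma0 N) 2} (hf : IsNewformOf W f)
    {Lsharp Lflat : IwasawaAlgebra p} (hSP : IsSprungPair f p (W.frobeniusTrace p) Lsharp Lflat)
    (ξ : IwasawaAlgebra p) (hC : (PowerSeries.X : IwasawaAlgebra p) ^ W.mordellWeilRank ∣ ξ)
    (hKato : (∀ m : ℕ, W.HasSurjectiveModNGaloisRep (p ^ m : ℕ)) → ξ ∣ Lflat)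
    {n : ℕ} (hn : Even n) {Θ : IwasawaAlgebra p}
    (hΘ : iwasawaToPowerSeries p Θ =
      ((mazurTateElement f p n).map (algebraMap ℚ ℚ_[p]) : PowerSeries ℚ_[p]))
    (hΘ0 : Θ ≠ 0) (hμ : mu Θ = 0) (hlam : lam Θ = (cyclotomicOmegaMinus p n).natDegree + 1)
    (hlt : lam Θ < p ^ n)
    (hBKO : Ideal.span ({ξ} : Set (IwasawaAlgebra p)) = Ideal.span {Lflat} → MissingPPartAt W p) :
    BSDp W p :=
  X8.bsdp_of_mazurTate_flat_of_bkoLink_of_analyticRank_eq_one_of_tower W p hGZK hX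
    (ClassX8.towerSurj_of_frobenius W p hX hs ℓ hgoodℓ hℓ9 ha9) h1 hf hSP ξ hC hKato hn hΘ hΘ0 hμ
    hlam hlt hBKO

/-- **X8 ∧ `r_an = 0` ∧ surj(3) + Frobenius witness: `BSD(E,3) ⟺ (ξ•) = (L•_3(E))` — no Lemma
20.** PER PAIR. [cite: Sprung2012, Thm. 7.16, Prop. 7.19 and Main Conj. 7.21 (pp. 1504–1505)]
[cite: Sprung2024, Lemmas 5.5–5.9 (pp. 40–41)] [cite: SerreAbelianLadic1968, Ch. IV §3.4, Lemma 3 (IV-23)] -/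
theorem X8.bsdp_iff_span_eq_span_chromaticL_of_analyticRank_eq_zero_of_frobenius
    (h3 : realPeriodRat_eq_unit_mul_plusPeriod_three)
    (hGZK : rank_eq_analyticRank_of_analyticRank_le_one) (hmod : hasEntireLFunction_rat)
    (hX : ClassX8 W p) (hs : Surj W p)
    (ℓ : ℕ) [Fact ℓ.Prime] (hgoodℓ : W.HasGoodReductionAtPrime ℓ)
    (hℓ9 : ℓ % 9 = 2 ∨ ℓ % 9 = 5) (ha9 : W.frobeniusTrace ℓ % 9 = 3 ∨ W.frobeniusTrace ℓ % 9 = 6)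
    (h0 : W.analyticRank = 0)
    {N : ℕ} [NeZero N] {f : CuspForm (Gamma0 N) 2} (hf : IsNewformOf W f)
    {Lsharp Lflat : IwasawaAlgebra p} (hSP : IsSprungPair f p (W.frobeniusTrace p) Lsharp Lflat)
    (c : Chroma) (ξ : IwasawaAlgebra p) (hK : (⟨ξ, 0, 0⟩ : SignedDatum W p).EulerCharacteristic)
    (hKato : (∀ n : ℕ, W.HasSurjectiveModNGaloisRep (p ^ n : ℕ)) → ξ ∣ chromaticL c Lsharp Lflat) :
    BSDp W p ↔ Ideal.span ({ξ} : Set (IwasawaAlgebra p)) = Ideal.span {chromaticL c Lsharp Lflat} :=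
  X8.bsdp_iff_span_eq_span_chromaticL_of_analyticRank_eq_zero_of_tower W p h3 hGZK hmod hX
    (ClassX8.towerSurj_of_frobenius W p hX hs ℓ hgoodℓ hℓ9 ha9) h0 hf hSP c ξ hK hKato

end X8

/-! ### X7 at `p = 3` (`a_3 = 0`) fed by the Frobenius certificate -/

section X7

variable (W : WeierstrassCurve ℚ) [W.IsElliptic] [W.IsGloballyMinimal] (p : ℕ) [Fact p.Prime]

/-- **X7@3 ∧ `r_an = 1` ∧ `a_3 = 0` ∧ surj(3) + Frobenius witness, sign `ε = −1`: `BSD(E,3)` from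
ONE odd-level Mazur–Tate certificate, every other input a named fact — no Lemma 20.** PER PAIR.
[cite: BurungaleKobayashiOta2023, App. A Cor. A.5] [cite: Kobayashi2003, Thm. 7.4, Thm. 1.2, Thm. 4.1 and Conjecture (p. 2)]
[cite: SerreAbelianLadic1968, Ch. IV §3.4, Lemma 3 (IV-23)] [cite: Miller2011LMS, §1 and Def. 1.1] -/
theorem X7.bsdp_of_mazurTate_odd_of_corA5_of_analyticRank_eq_one_of_frobenius_three
    (h12 : Kobayashi2003.thm12_signedSelmerDual_finite_torsion)
    (h41 : Kobayashi2003.thm41_signedCharIdeal_divisibility)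
    (h5 : realPeriodRat_eq_unit_mul_plusPeriod) (h3 : realPeriodRat_eq_unit_mul_plusPeriod_three)
    (hGZK : rank_eq_analyticRank_of_analyticRank_le_one) (hmod : hasEntireLFunction_rat)
    (hA5 : corA5_pPart_of_signedCharIdeal_eq)
    (hp3 : p = 3) (hX : ClassX7 W p) (hap : W.frobeniusTrace p = 0) (hs : Surj W p)
    (ℓ : ℕ) [Fact ℓ.Prime] (hgoodℓ : W.HasGoodReductionAtPrime ℓ)
    (hℓ9 : ℓ % 9 = 2 ∨ ℓ % 9 = 5) (ha9 : W.frobeniusTrace ℓ % 9 = 3 ∨ W.frobeniusTrace ℓ % 9 = 6)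
    (h1 : W.analyticRank = 1)
    [NeZero (W.conductorNorm ℤ)] {f₀ : CuspForm (Gamma0 (W.conductorNorm ℤ)) 2} (hf₀ : IsNewformOf W f₀)
    {n : ℕ} (hn : Odd n) {Θ : IwasawaAlgebra p}
    (hΘ : iwasawaToPowerSeries p Θ =
      ((mazurTateElement f₀ p n).map (algebraMap ℚ ℚ_[p]) : PowerSeries ℚ_[p]))
    (hΘ0 : Θ ≠ 0) (hμ : mu Θ = 0) (hlam : lam Θ = (cyclotomicOmegaPlus p n).natDegree + 1)
    (hlt : lam Θ < p ^ n) : BSDp W p :=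
  bsdp_of_mazurTate_odd_of_corA5_of_analyticRank_eq_one_of_tower W p h12 h41 h5 h3 hGZK hmod hA5
    (by omega) hX.1.1 hap (towerSurj_of_frobenius_of_eq_three W p hp3 hs ℓ hgoodℓ hℓ9 ha9) h1 hf₀ hn
    hΘ hΘ0 hμ hlam hlt

/-- **X7@3 ∧ `r_an = 1` ∧ `a_3 = 0` ∧ surj(3) + Frobenius witness, sign `ε = 1`: `BSD(E,3)` from ONE
even-level Mazur–Tate certificate, every other input a named fact — no Lemma 20.** PER PAIR.
[cite: BurungaleKobayashiOta2023, App. A Cor. A.5] [cite: Kobayashi2003, Thm. 7.4, Thm. 1.2, Thm. 4.1 and Conjecture (p. 2)]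
[cite: SerreAbelianLadic1968, Ch. IV §3.4, Lemma 3 (IV-23)] [cite: Miller2011LMS, §1 and Def. 1.1] -/
theorem X7.bsdp_of_mazurTate_even_of_corA5_of_analyticRank_eq_one_of_frobenius_three
    (h12 : Kobayashi2003.thm12_signedSelmerDual_finite_torsion)
    (h41 : Kobayashi2003.thm41_signedCharIdeal_divisibility)
    (h5 : realPeriodRat_eq_unit_mul_plusPeriod) (h3 : realPeriodRat_eq_unit_mul_plusPeriod_three)
    (hGZK : rank_eq_analyticRank_of_analyticRank_le_one) (hmod : hasEntireLFunction_rat)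
    (hA5 : corA5_pPart_of_signedCharIdeal_eq)
    (hp3 : p = 3) (hX : ClassX7 W p) (hap : W.frobeniusTrace p = 0) (hs : Surj W p)
    (ℓ : ℕ) [Fact ℓ.Prime] (hgoodℓ : W.HasGoodReductionAtPrime ℓ)
    (hℓ9 : ℓ % 9 = 2 ∨ ℓ % 9 = 5) (ha9 : W.frobeniusTrace ℓ % 9 = 3 ∨ W.frobeniusTrace ℓ % 9 = 6)
    (h1 : W.analyticRank = 1)
    [NeZero (W.conductorNorm ℤ)] {f₀ : CuspForm (Gamma0 (W.conductorNorm ℤ)) 2} (hf₀ : IsNewformOf W f₀)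
    {n : ℕ} (hn : Even n) {Θ : IwasawaAlgebra p}
    (hΘ : iwasawaToPowerSeries p Θ =
      ((mazurTateElement f₀ p n).map (algebraMap ℚ ℚ_[p]) : PowerSeries ℚ_[p]))
    (hΘ0 : Θ ≠ 0) (hμ : mu Θ = 0) (hlam : lam Θ = (cyclotomicOmegaMinus p n).natDegree + 1)
    (hlt : lam Θ < p ^ n) : BSDp W p :=
  bsdp_of_mazurTate_even_of_corA5_of_analyticRank_eq_one_of_tower W p h12 h41 h5 h3 hGZK hmod hA5
    (by omega) hX.1.1 hap (towerSurj_of_frobenius_of_eq_three W p hp3 hs ℓ hgoodℓ hℓ9 ha9) h1 hf₀ hn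
    hΘ hΘ0 hμ hlam hlt

end X7

end Summit.BirchSwinnertonDyer.Rank1Residual.Supersingular

end
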